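import Summits.CriticalPhenomena.CardyFormulaZ2.Theorems.CardyComplexConeEdgePrecompactPassageAgree
import Literature.Probability.LatticeModels.MeshDomainJordan

/-!
# The two dynamics agree off the collar
(line `qkz-strip-boundary-arm` of crux `CardyComplexCone.EdgePrecompact`, stmt-CriticalPhenomena-11387;
geometric input of the uniform forward response stability "UFRS", item 1 of the road map in
`Theorems/CardyComplexConeEdgePrecompactResponseStabilityUniform.lean`)

For a Jordan Dobrushin domain `D` and `η > 0` there is `δ₀ > 0` such that for every `ℤ²`-admissible
datum `E` with `E.Ω = D.carrier` and mesh `E.δ < δ₀`, every lattice shift `w` with `‖E.δ w‖ < η` and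
every site `x` at distance `≥ 3η` from `Dᶜ`: at every site `y` within `2 E.δ` of `x` (so `x` itself and
its lattice neighbours), the four target edges have in BOTH completed configurations
`E.bcBondConfig ω` and `(shiftData E w).bcBondConfig ω` the status they have in `ω`, and every face
with corner `y` is inner for BOTH data (`collarAgreement`, registered sub-goal). Consequently Smirnov's
successor maps `nextCorner`, the turns `turnOf` and the inner-face predicates of the two data coincide
at all corners whose vertex is `3η`-deep: the last synchronised corner produced by
`responseLocalisation` (`…EdgePrecompactResponseLocalisation.lean`) lies in the `3η`-collar of `∂D`.

Proof: the bulk theorem for Jordan domains (`JordanDomain.exists_forall_mem_meshDomain_and_reachable`,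
`MeshDomainJordan.lean`) on the compact `{z | η ≤ infDist z Dᶜ}` makes every lattice edge near a
`2η`-deep point an edge of the discrete domain once `E.δ < δ₀`; the depth lemmas of
`…EdgePrecompactPassageAgree.lean` (`isInnerFace_of_deep`, `mem_bcBondConfig_iff_of_deep`) turn this into
the statement for `E`, and the translated graph (`adj_shiftData_iff`) into the statement for
`shiftData E w`, whose `3η`-deep points are `2η`-deep for `D` translated back by `δw`.

References: S. Smirnov, C. R. Acad. Sci. Paris 333 (2001), §2; G. Grimmett, *Percolation* (1999), §11.2.
-/

namespace Summit.CriticalPhenomena.CardyFormulaZ2.Cruxes.EdgePrecompact.QkzStripBoundaryArm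

open MeasureTheory Filter Set Metric
open scoped Topology BigOperators Pointwise
open Literature.Probability.LatticeModels Literature.Probability.Percolation
open Literature.Probability.RandomPlanarGeometry (DobrushinDomain)
open Summit.CriticalPhenomena.CardyFormulaZ2.Theses.CardyComplexCone

noncomputable section

/-- Points at positive distance from the complement of an open set lie in the set. -/
theorem mem_of_infDist_compl_pos {Ω : Set ℂ} (hΩ : IsOpen Ω) (hne : Ωᶜ.Nonempty) {z : ℂ}
    (hz : 0 < infDist z Ωᶜ) : z ∈ Ω := by
  by_contra h
  exact ((hΩ.isClosed_compl.notMem_iff_infDist_pos hne).2 hz) h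

/-- The super-level sets of the distance to the complement of a bounded open set are compact subsets. -/
theorem isCompact_le_infDist_compl {Ω : Set ℂ} (hΩ : IsOpen Ω) (hb : Bornology.IsBounded Ω)
    {η : ℝ} (hη : 0 < η) :
    IsCompact {z : ℂ | η ≤ infDist z Ωᶜ} ∧ {z : ℂ | η ≤ infDist z Ωᶜ} ⊆ Ω := by
  have hne : Ωᶜ.Nonempty := by
    obtain ⟨r, hr⟩ := hb.subset_closedBall 0
    refine ⟨((|r| + 1 : ℝ) : ℂ), fun h => ?_⟩
    have h1 := hr h
    rw [mem_closedBall, dist_zero_right, Complex.norm_real, Real.norm_eq_abs,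
      abs_of_pos (by positivity : (0:ℝ) < |r| + 1)] at h1
    linarith [le_abs_self r]
  have hsub : {z : ℂ | η ≤ infDist z Ωᶜ} ⊆ Ω := fun z hz =>
    mem_of_infDist_compl_pos hΩ hne (lt_of_lt_of_le hη hz)
  refine ⟨Metric.isCompact_of_isClosed_isBounded (isClosed_le continuous_const
    (continuous_infDist_pt _)) (hb.subset hsub), hsub⟩

/-- Lattice neighbours have mesh points at distance exactly `|δ|` (sharper than the tree's
`dist_meshPoint_add_cornerUnit_le`; with it the conclusion of `collarAgreement` at `y = x + cornerUnit k`
is available from the hypothesis `dist ≤ 2 E.δ`). -/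
theorem dist_meshPoint_add_cornerUnit_eq (δ : ℝ) (x : Site 2) (k : Fin 4) :
    dist (meshPoint δ (x + cornerUnit k)) (meshPoint δ x) = |δ| := by
  rw [meshPoint_add_shift, dist_eq_norm, add_sub_cancel_right, meshPoint, toComplex_cornerUnit, norm_mul,
    Complex.norm_real, Real.norm_eq_abs, norm_pow, Complex.norm_I, one_pow, mul_one]

/-- **The two dynamics agree off the collar** (registered sub-goal `collarAgreement` of
stmt-CriticalPhenomena-11387; item 1 of the UFRS road map). For `η > 0` there is `δ₀ > 0` such that
for every admissible datum `E` of `D` with `E.δ < δ₀`, every shift `w` with `‖E.δ w‖ < η`, every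
configuration `ω` and every site `x` with `3η ≤ infDist (E.δ x) Dᶜ`: at every site `y` with
`dist (E.δ y, E.δ x) ≤ 2 E.δ`, the target edges of the four corners at `y` have their `ω`-status in
both completed configurations, and every face with corner `y` is inner for both `E` and
`shiftData E w`. -/
theorem collarAgreement : ∀ (D : DobrushinDomain) (η : ℝ), 0 < η → ∃ δ₀ > (0:ℝ), ∀ E : DiscreteDobrushin, E.Ω = D.carrier → E.IsZdAdmissible → E.δ < δ₀ → ∀ w : Site 2, ‖meshPoint E.δ w‖ < η → ∀ (ω : BondConfig (Site 2)) (x : Site 2), 3 * η ≤ infDist (meshPoint E.δ x) D.carrierᶜ → ∀ y : Site 2, dist (meshPoint E.δ y) (meshPoint E.δ x) ≤ 2 * E.δ → (∀ k : Fin 4, (cTgt (y, k) ∈ E.bcBondConfig ω ↔ cTgt (y, k) ∈ ω) ∧ (cTgt (y, k) ∈ (shiftData E w).bcBondConfig ω ↔ cTgt (y, k) ∈ ω)) ∧ (∀ f : Site 2, IsCorner y f → E.IsInnerFace f ∧ (shiftData E w).IsInnerFace f) := by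
  intro D η hη
  set Ω := D.carrier with hΩdef
  obtain ⟨hK, hKΩ⟩ := isCompact_le_infDist_compl D.isOpen D.isBounded hη
  obtain ⟨δ₁, hδ₁, hbulk⟩ := D.toJordanDomain.exists_forall_mem_meshDomain_and_reachable hK hKΩ
  refine ⟨min δ₁ (η / 32), lt_min hδ₁ (by positivity), ?_⟩
  intro E hEΩ hE hEδ w hw ω x hx y hy
  have hδ : 0 < E.δ := hE.delta_pos
  have hδ₁' : E.δ < δ₁ := lt_of_lt_of_le hEδ (min_le_left _ _)
  have hδη : E.δ < η / 32 := lt_of_lt_of_le hEδ (min_le_right _ _)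
  have hmem : ∀ u : Site 2, η ≤ infDist (meshPoint E.δ u) Ωᶜ → u ∈ meshDomain Ω E.δ :=
    fun u hu => (hbulk E.δ hδ hδ₁').1 u hu
  -- every lattice edge at a site within `η/2` of a `2η`-deep point is an edge of the discrete domain
  have hdeep : ∀ z : ℂ, 2 * η ≤ infDist z Ωᶜ → ∀ u v : Site 2, dist (meshPoint E.δ u) z < η / 2 →
      (zdGraph 2).Adj u v → (discreteDomainGraph Ω E.δ).Adj u v := by
    intro z hz u v hu huv
    obtain ⟨k, rfl⟩ := exists_eq_add_cornerUnit huv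
    have hv : dist (meshPoint E.δ (u + cornerUnit k)) (meshPoint E.δ u) ≤ 4 * E.δ :=
      dist_meshPoint_add_cornerUnit_le hδ.le u k
    have hdeepu : ∀ p : ℂ, dist p (meshPoint E.δ u) ≤ 4 * E.δ → η ≤ infDist p Ωᶜ := by
      intro p hp
      have h1 := infDist_le_infDist_add_dist (x := z) (y := p) (s := Ωᶜ)
      have h2 := dist_triangle z (meshPoint E.δ u) p
      rw [dist_comm] at hu
      rw [dist_comm] at hp
      linarith
    rw [discreteDomainGraph_adj_iff, meshGraph_adj_iff]
    refine ⟨⟨huv, ?_⟩, hmem u (hdeepu _ (by simp; positivity)), hmem _ (hdeepu _ hv)⟩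
    refine ((convex_closedBall (meshPoint E.δ u) (4 * E.δ)).segment_subset
      (mem_closedBall_self (by positivity)) (mem_closedBall.2 hv)).trans fun p hp => ?_
    exact subset_closure (hKΩ (hdeepu p (mem_closedBall.1 hp)))
  -- depth of the two data around `E.δ x`
  have hdeep₀ : ∀ u v : Site 2, dist (meshPoint E.δ u) (meshPoint E.δ x) < η / 2 →
      (zdGraph 2).Adj u v → (discreteDomainGraph E.Ω E.δ).Adj u v := by
    rw [hEΩ]; exact hdeep _ (by linarith)
  have hdeep₁ : ∀ u v : Site 2, dist (meshPoint E.δ u) (meshPoint E.δ x) < η / 2 →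
      (zdGraph 2).Adj u v →
      (discreteDomainGraph (shiftData E w).Ω (shiftData E w).δ).Adj u v := by
    intro u v hu huv
    have hz' : 2 * η ≤ infDist (meshPoint E.δ x - meshPoint E.δ w) Ωᶜ := by
      have h1 := infDist_le_infDist_add_dist (x := meshPoint E.δ x)
        (y := meshPoint E.δ x - meshPoint E.δ w) (s := Ωᶜ)
      have h2 : dist (meshPoint E.δ x) (meshPoint E.δ x - meshPoint E.δ w) = ‖meshPoint E.δ w‖ := by
        rw [dist_eq_norm, sub_sub_cancel]
      linarith
    have key : (discreteDomainGraph E.Ω E.δ).Adj (u - w) (v - w) := by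
      rw [hEΩ]
      refine hdeep _ hz' _ _ ?_ ((zdGraph_adj_shift_iff w (u - w) (v - w)).1
        (by simpa only [Site.shift_apply, sub_add_cancel] using huv))
      have hsub : meshPoint E.δ (u - w) = meshPoint E.δ u - meshPoint E.δ w :=
        eq_sub_of_add_eq (by rw [add_comm, ← meshPoint_add_shift, sub_add_cancel])
      rw [hsub, dist_eq_norm, sub_sub_sub_cancel_right, ← dist_eq_norm]
      exact hu
    have := (adj_shiftData_iff E w (u - w) (v - w)).2 key
    simpa only [sub_add_cancel] using this
  have hy' : dist (meshPoint E.δ y) (meshPoint E.δ x) < η / 2 - 8 * E.δ := by linarith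
  refine ⟨fun k => ⟨?_, ?_⟩, fun f hf => ⟨?_, ?_⟩⟩
  · exact mem_bcBondConfig_iff_of_deep hdeep₀ hδ.le (k + 1) hy' ω
  · exact mem_bcBondConfig_iff_of_deep (E := shiftData E w) hdeep₁ hδ.le (k + 1) hy' ω
  · refine isInnerFace_of_deep hdeep₀ hδ.le ?_
    have h1 := dist_meshPoint_le_of_isCorner hδ.le hf
    have h2 := dist_triangle (meshPoint E.δ f) (meshPoint E.δ y) (meshPoint E.δ x)
    rw [dist_comm] at h1
    linarith
  · refine isInnerFace_of_deep (E := shiftData E w) hdeep₁ hδ.le ?_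
    have h1 := dist_meshPoint_le_of_isCorner hδ.le hf
    have h2 := dist_triangle (meshPoint E.δ f) (meshPoint E.δ y) (meshPoint E.δ x)
    rw [dist_comm] at h1
    show dist (meshPoint E.δ f) (meshPoint E.δ x) < η / 2 - 2 * E.δ
    linarith

/-- **No discrepancy at a deep corner.** Under the conclusion of `collarAgreement` at the site `x`
(read as a hypothesis), at every corner `(x, k)`: its target edge has the same status in the two
completed configurations, and the successor corner — for either dynamics — has a face that is inner
for both data. Hence the FACE and SPLIT discrepancies of `responseLocalisation` never sit at a corner
whose vertex is `3η`-deep. -/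
theorem no_discrepancy_of_agree {E : DiscreteDobrushin} {w : Site 2} {ω : BondConfig (Site 2)} {x : Site 2}
    (hδ : 0 ≤ E.δ)
    (hagree : ∀ y : Site 2, dist (meshPoint E.δ y) (meshPoint E.δ x) ≤ 2 * E.δ →
      (∀ k : Fin 4, (cTgt (y, k) ∈ E.bcBondConfig ω ↔ cTgt (y, k) ∈ ω) ∧
        (cTgt (y, k) ∈ (shiftData E w).bcBondConfig ω ↔ cTgt (y, k) ∈ ω)) ∧
      (∀ f : Site 2, IsCorner y f → E.IsInnerFace f ∧ (shiftData E w).IsInnerFace f))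
    (k : Fin 4) (β : BondConfig (Site 2)) :
    (cTgt (x, k) ∈ E.bcBondConfig ω ↔ cTgt (x, k) ∈ (shiftData E w).bcBondConfig ω) ∧
      E.IsInnerFace (cFace (nextCorner β (x, k))) ∧
      (shiftData E w).IsInnerFace (cFace (nextCorner β (x, k))) := by
  have hx := hagree x (by rw [dist_self]; positivity)
  refine ⟨(hx.1 k).1.trans (hx.1 k).2.symm, ?_⟩
  by_cases hm : cTgt (x, k) ∈ β
  · rw [nextCorner_of_mem hm]
    have hy := hagree (x + cornerUnit (k + 1))
      (by rw [dist_meshPoint_add_cornerUnit_eq, abs_of_nonneg hδ]; linarith)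
    exact hy.2 _ (isCorner_cFace (x + cornerUnit (k + 1), k + 3))
  · rw [nextCorner_of_not_mem hm]
    exact hx.2 _ (isCorner_cFace (x, k + 1))

end

end Summit.CriticalPhenomena.CardyFormulaZ2.Cruxes.EdgePrecompact.QkzStripBoundaryArm
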